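import Summits.FinalStateConjecture.FinalStateConjecture.Theorems.ZeroEnergyKerrOrBombStationaryLimitReductionKerrIsometryRigidityWave3Facts
import Summits.FinalStateConjecture.FinalStateConjecture.Theorems.ZeroEnergyKerrOrBombStationaryLimitReductionTimeEquivariantMaps
import Literature.Geometry.Lorentzian.KerrScriLeafGap
import Literature.Geometry.Lorentzian.KerrStarCoord
import Literature.Geometry.Lorentzian.KerrWaveEnergy
import Literature.Geometry.Lorentzian.KerrSchildEnergyEstimate
import HarnessLib

/-!
# Route ZeroEnergyKerrOrBomb · crux `FinalStateFromKerrOrBomb` (stmt-FinalStateConjecture-17839), line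
# `SketchIdeator1` — stub `stub_kerrAsymptoticRigidity` (F4 of stub 1R), layer 8: THE MASSES AGREE, and the radial
# distortion of the chart identification is bounded

Helper file (`--supports stmt-FinalStateConjecture-17839`; registered helper `kerrAsymptoticRigidity_mass_and_radius`) of
the lead's wave-2 stub-worker for `stub_kerrAsymptoticRigidity : SigM.stub_kerrAsymptoticRigidity`
(`:= KerrAsymptoticRigidity`, obligation F4 of stub 1R, `…KerrIsometryRigidityWave3Facts`). Hypotheses: the binder list
of `KerrAsymptoticRigidity` VERBATIM, then `c = 1` (layer 1), a linear map `Λ` with `Λ e₀ = c e₀` preserving `η`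
(layer 6) with the drift bound `‖Θ x − Λ x‖ ≤ C₇ √r` (layer 7, p139609), and the comparability of radii (layer 4,
p138872). Conclusions: (i) the Schwarzschild mass of the adapted chart can be taken EQUAL to the Kerr mass `M` in the
`C²` clause of `ChartIsAsymptoticallySchwarzschildean'`; (ii) `|A.radius (Θ x) − r(x)| ≤ L₈` far out (the radial half of
the asymptotic clause of `IsKerrChartedWith`).

Proof: the `(e₀, e₀)` component of the isometry (`dΘ e₀ = e₀`) is `2H(x) = A.bilin(Θ x)(e₀, e₀) + 1 = 2M_A/σ + E₀₀`,
`σ = ‖(Θ x)_{space}‖`, `|E₀₀| ≤ C/r_A² ≤ C'/r²`, and `|2H − 2M/r| ≤ 2Ma²/r³` (`Kerr.div_le_scalarH`,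
`Kerr.scalarH_le_div`); hence `|M_A r − M σ| ≤ C₁₀` far out. By the drift bound and `‖(Λ x)_{space}‖ = ‖x_{space}‖`
(`Λ` is `η`-orthogonal and fixes `e₀`), `|σ − r| ≤ C₇ √r + |a|`; so `|M_A − M| r ≤ C₁₀ + M (C₇ √r + |a|)` for all large
`r`, forcing `M_A = M` (`M > 0`), and then `|σ − r| ≤ C₁₀/M`, `|r_A − σ| ≤ C_A`.

Elementary; no named fact, nothing restated. References: R. Bartnik, CPAM 39 (1986), §4 (uniqueness of the mass);
P. T. Chruściel, J. L. Costa, arXiv:0806.0016, §2.1; M. Visser, arXiv:0706.0622, (33).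
-/

set_option linter.dupNamespace false

-- instance search through the nested operator types `E4 →L[ℝ] E4 →L[ℝ] ℝ`
set_option maxSynthPendingDepth 3

noncomputable section

open scoped Manifold ContDiff Topology
open Set Filter Function

namespace Summit.FinalStateConjecture.FinalStateConjecture.Theorems.SymplecticDualOfTheBomb

open Literature.Geometry.Lorentzian
open Summit.FinalStateConjecture.FinalStateConjecture.Theorems.OneLockedExplosion

/-! ## §1 Preliminaries -/

/-- `‖e₀‖ = 1`. [folklore] -/
private theorem norm_basisVector_zero : ‖(E4.basisVector 0 : E4)‖ = 1 := by
  rw [E4.basisVector, PiLp.norm_single, norm_one]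

/-- `η(w, w) = ‖w‖² − 2 (w⁰)²` (Euclidean norm of `E4`). [folklore] -/
private theorem minkowski_self_eq (w : E4) : Minkowski.bilin w w = ‖w‖ ^ 2 - 2 * w 0 ^ 2 := by
  have h : ‖w‖ ^ 2 = w 0 ^ 2 + ∑ i : Fin 3, w i.succ ^ 2 := by
    rw [EuclideanSpace.real_norm_sq_eq, Fin.sum_univ_succ]
  rw [Minkowski.bilin_apply, h]
  have h2 : ∑ i : Fin 3, w i.succ * w i.succ = ∑ i : Fin 3, w i.succ ^ 2 :=
    Finset.sum_congr rfl fun i _ ↦ by ring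
  rw [h2]
  ring

/-- `‖u‖² = (u⁰)² + ‖u_{space}‖²`. [folklore] -/
private theorem norm_sq_eq_time_sq_add (u : E4) : ‖u‖ ^ 2 = (u 0) ^ 2 + E4.spatialNorm u ^ 2 := by
  rw [EuclideanSpace.real_norm_sq_eq, E4.spatialNorm_sq, Fin.sum_univ_four]
  ring

/-- **An `η`-orthogonal map fixing `e₀` preserves the spatial norm**: `‖(Λ x)_{space}‖ = ‖x_{space}‖`.
(With `p = (0, x_{space})`: `(Λ p)⁰ = −η(e₀, Λ p) = −η(e₀, p) = 0` and `η(Λ p, Λ p) = η(p, p) = ‖x_{space}‖²`.)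
O'Neill 1983, Ch. 9, p. 236 (`O(1, 3)` stabiliser of a timelike vector is `O(3)`). [folklore] -/
private theorem spatialNorm_map_eq {Λ : E4 →L[ℝ] E4} (hΛ0 : Λ (E4.basisVector 0) = E4.basisVector 0)
    (hΛη : ∀ v w : E4, Minkowski.bilin (Λ v) (Λ w) = Minkowski.bilin v w) (x : E4) :
    E4.spatialNorm (Λ x) = E4.spatialNorm x := by
  set p : E4 := E4.ofTimeSpace 0 (E4.spatial x) with hp
  have hx : x = p + E4.time x • E4.basisVector 0 := (ofTimeSpace_zero_spatial_add_time_smul x).symm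
  have hp0 : p 0 = 0 := rfl
  -- `(Λ p)⁰ = 0`
  have h1 : Λ p 0 = 0 := by
    have h := hΛη (E4.basisVector 0) p
    rw [hΛ0, Minkowski.bilin_basisVector_zero_left, Minkowski.bilin_basisVector_zero_left, hp0, neg_zero,
      neg_eq_zero] at h
    exact h
  -- `‖Λ p‖ = ‖p‖`
  have h2 : ‖Λ p‖ ^ 2 = ‖p‖ ^ 2 := by
    have h := hΛη p p
    rw [minkowski_self_eq, minkowski_self_eq, h1, hp0] at h
    linarith
  have hsp : E4.spatial (Λ x) = E4.spatial (Λ p) := by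
    rw [hx, map_add, map_smul, hΛ0, map_add, map_smul, E4.spatial_basisVector_zero, smul_zero, add_zero]
  have h3 : E4.spatialNorm (Λ p) ^ 2 = E4.spatialNorm p ^ 2 := by
    have e1 := norm_sq_eq_time_sq_add (Λ p)
    have e2 := norm_sq_eq_time_sq_add p
    rw [h1] at e1
    rw [hp0] at e2
    nlinarith
  have h4 : E4.spatialNorm (Λ p) = E4.spatialNorm p :=
    (pow_left_inj₀ (E4.spatialNorm_nonneg _) (E4.spatialNorm_nonneg _) two_ne_zero).1 h3
  rw [E4.spatialNorm, hsp, ← E4.spatialNorm, h4, hp, E4.spatialNorm_ofTimeSpace, E4.spatialNorm]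

/-- `g_{M,a}(x)(e₀, e₀) = −1 + 2H(x)` (`ℓ₀ = 1`). Kerr–Schild 1965, §2. [folklore] -/
private theorem kerr_bilin_basisVector_zero_zero (M a : ℝ) (x : E4) :
    Kerr.bilin M a x (E4.basisVector 0) (E4.basisVector 0) = -1 + 2 * Kerr.scalarH M a x := by
  have h0 : Kerr.nullCovectorFun a x 0 = 1 := rfl
  rw [Kerr.bilin_basisVector, h0]
  simp [Kerr.etaComp]

/-- For `a = 0`, `H = M/‖x_{space}‖` wherever `‖x_{space}‖ ≠ 0`. [folklore] -/
private theorem scalarH_zero_spin (M : ℝ) {x : E4} (hx : E4.spatialNorm x ≠ 0) :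
    Kerr.scalarH M 0 x = M / E4.spatialNorm x := by
  rw [Kerr.scalarH, Kerr.radius_zero_left]
  field_simp
  ring

/-- `‖x_{space}‖ ≤ r(x) + |a|` on `{r > 0}`. [folklore] -/
private theorem spatialNorm_le_radius_add {a : ℝ} {x : E4} (hx : 0 < Kerr.radius a x) :
    E4.spatialNorm x ≤ Kerr.radius a x + |a| := by
  have h := Kerr.norm_le_radius_add_abs (a := a) (y := E4.spatial x) (by rwa [Kerr.radius_ofTimeSpace_spatial])
  rwa [Kerr.radius_ofTimeSpace_spatial] at h

/-- The Kerr exterior has points of arbitrarily large Kerr–Schild radius. [folklore] -/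
private theorem exists_mem_exterior_le_radius (M a K : ℝ) :
    ∃ x ∈ (Kerr.exterior M a : Set E4), K ≤ Kerr.radius a x := by
  set K' : ℝ := max K (max (Kerr.rPlus M a) 0 + 1) with hK'
  have hK'0 : 0 ≤ K' := le_max_of_le_right (by positivity)
  set y : E3 := EuclideanSpace.single 0 (K' + |a|) with hy
  have hyn : ‖y‖ = K' + |a| := by
    rw [hy, PiLp.norm_single, Real.norm_eq_abs, abs_of_nonneg (by positivity)]
  have h1 := Kerr.spatialNorm_sq_sub_sq_le_radius_sq a (E4.ofTimeSpace 0 y)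
  rw [E4.spatialNorm_ofTimeSpace, hyn] at h1
  have h2 : K' ^ 2 ≤ Kerr.radius a (E4.ofTimeSpace 0 y) ^ 2 := by nlinarith [abs_nonneg a, sq_abs a]
  have h3 : K' ≤ Kerr.radius a (E4.ofTimeSpace 0 y) :=
    (pow_le_pow_iff_left₀ hK'0 (Kerr.radius_nonneg _ _) two_ne_zero).1 h2
  refine ⟨E4.ofTimeSpace 0 y, ?_, (le_max_left _ _).trans h3⟩
  rw [SetLike.mem_coe, Kerr.mem_exterior]
  have : max (Kerr.rPlus M a) 0 + 1 ≤ K' := le_max_right _ _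
  linarith

/-! ## §2 The masses agree; the radial distortion is bounded -/


/-- **Registered helper `kerrAsymptoticRigidity_mass_and_radius`** (layer 8 of F4 = `KerrAsymptoticRigidity`; its binder list
verbatim, then `c = 1` (layer 1), a linear `η`-orthogonal `Λ` with `Λ e₀ = c e₀` and the drift bound `‖Θ x − Λ x‖ ≤ C₇ √r`
(layers 6–7), and the comparability of radii (layer 4)): (i) THE MASSES AGREE — the `C²`-Schwarzschildean clause of the
adapted chart holds with Schwarzschild mass equal to the Kerr mass `M`; (ii) the radial distortion `|A.radius (Θ x) − r(x)|`
is bounded far out. The `(e₀, e₀)` component of the isometry (`dΘ e₀ = e₀`) gives `|M_A r − M σ| ≤ C₁₀`,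
`σ = ‖(Θ x)_{space}‖` (`2H = 2M_A/σ + O(r_A⁻²)`, `|2H − 2M/r| ≤ 2Ma²/r³`, radii comparable), while the drift bound and
`‖(Λ x)_{space}‖ = ‖x_{space}‖` give `|σ − r| ≤ C₇ √r + |a|`; so `|M_A − M| r = O(√r)`, i.e. `M_A = M` (`M > 0`), and then
`|σ − r| ≤ C₁₀/M`. Bartnik 1986, §4 (the mass is a geometric invariant); Chruściel–Costa arXiv:0806.0016, §2.1. [folklore] -/
theorem kerrAsymptoticRigidity_mass_and_radius : ∀ (𝓑 : StationaryAFBlackHole.{0}) (A : 𝓑.AdaptedChart) (M a c : ℝ) (Θ : E4 → E4), ChartIsAsymptoticallyCartesian A → ChartIsAsymptoticallySchwarzschildean' A → Kerr.IsSubextremal M a → 0 < c → ContDiffOn ℝ ∞ Θ (Kerr.exterior M a : Set E4) → Set.InjOn Θ (Kerr.exterior M a : Set E4) → Set.MapsTo Θ (Kerr.exterior M a : Set E4) (A.domain : Set E4) → (∀ x ∈ (Kerr.exterior M a : Set E4), ∀ s : ℝ, Θ (x + s • E4.basisVector 0) = Θ x + (c * s) • E4.basisVector 0) → (∀ x ∈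 (Kerr.exterior M a : Set E4), ∀ v w : E4, A.bilin (Θ x) (fderiv ℝ Θ x v) (fderiv ℝ Θ x w) = Kerr.bilin M a x v w) → Θ '' (Kerr.exterior M a : Set E4) = {u : E4 | ∃ h : u ∈ A.domain, A.toFun ⟨u, h⟩ ∈ 𝓑.doc} → (∀ R₁ : ℝ, ∃ R : ℝ, ∀ x ∈ (Kerr.exterior M a : Set E4), R ≤ Kerr.radius a x → R₁ ≤ A.radius (Θ x)) → c = 1 → ∀ (Λ : E4 →L[ℝ] E4) (R₇ C₇ : ℝ), Λ (E4.basisVector 0) = c • E4.basisVector 0 → (∀ v w : E4, Minkowski.bilin (Λ v) (Λ w) = Minkowski.bilin v w) → (∀ x ∈ (Kerr.exterior M a : Set E4), R₇ ≤ Kerr.radius a x → ‖Θ x - Λ x‖ ≤ C₇ * Real.sqrt (Kerr.radius a x)) → (∃ R' C : ℝ, ∀ x ∈ (Kerr.exterior M a : Set E4), R' ≤ Kerr.radius a x → Kerr.radius a x ≤ C * A.radius (Θ x) ∧ A.radius (Θ x) ≤ C * Kerr.radius a x) → (∃ C R₀ : ℝ, ∀ x : A.domain, R₀ ≤ A.radius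 x.1 → ∀ n : ℕ, n ≤ 2 → ‖iteratedFDeriv ℝ n (fun y ↦ A.bilin y - Kerr.bilin M 0 y) x.1‖ ≤ C / (A.radius x.1) ^ (n + 2)) ∧ ∃ R₈ L₈ : ℝ, ∀ x ∈ (Kerr.exterior M a : Set E4), R₈ ≤ Kerr.radius a x → |A.radius (Θ x) - Kerr.radius a x| ≤ L₈ := by
  intro 𝓑 A M a c Θ _ hschw hMa hc hΘs _ hΘmaps hΘT hΘiso _ hfar hc1 Λ R₇ C₇ hΛ0 hΛη hdrift h4
  subst hc1
  rw [one_smul] at hΛ0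
  obtain ⟨R₄, C₄, hR₄⟩ := h4
  obtain ⟨MA, CA, RA, -, hder⟩ := hschw
  set S : Set E4 := (Kerr.exterior M a : Set E4) with hS_def
  have hSo : IsOpen S := (Kerr.exterior M a).isOpen
  have hM : 0 < M := hMa.pos
  obtain ⟨CA0, hCA0⟩ := A.exists_abs_radius_sub_spatialNorm_le
  obtain ⟨R₂, hR₂⟩ := hfar (max RA (|CA0| + 1))
  set Rbig : ℝ := max (max R₄ R₂) (max R₇ (max |a| 1)) with hRbig
  set C₉ : ℝ := |CA| * C₄ ^ 2 + 2 * M * a ^ 2 with hC₉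
  have hC₉0 : 0 ≤ C₉ := by positivity
  set C₁₀ : ℝ := C₉ * (|C₄| + |CA0|) / 2 with hC₁₀
  /- the pointwise estimates far out -/
  have hpt : ∀ x ∈ S, Rbig ≤ Kerr.radius a x →
      |MA * Kerr.radius a x - M * E4.spatialNorm (Θ x)| ≤ C₁₀ ∧
        |E4.spatialNorm (Θ x) - Kerr.radius a x| ≤ C₇ * Real.sqrt (Kerr.radius a x) + |a| := by
    intro x hx hxR
    set r : ℝ := Kerr.radius a x with hr_def
    have hr : 0 < r := Kerr.radius_pos_of_mem_region hx
    have hr1 : 1 ≤ r := ((le_max_right _ _).trans (le_max_right _ _)).trans ((le_max_right _ _).trans hxR)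
    have ha : |a| ≤ r := ((le_max_left _ _).trans (le_max_right _ _)).trans ((le_max_right _ _).trans hxR)
    have hR7 : R₇ ≤ r := (le_max_left _ _).trans ((le_max_right _ _).trans hxR)
    obtain ⟨h4a, h4b⟩ := hR₄ x hx (((le_max_left _ _).trans (le_max_left _ _)).trans hxR)
    have hfx := hR₂ x hx (((le_max_right _ _).trans (le_max_left _ _)).trans hxR)
    set rA : ℝ := A.radius (Θ x) with hrA_def
    have hRA : RA ≤ rA := (le_max_left _ _).trans hfx
    have hrA1 : |CA0| + 1 ≤ rA := (le_max_right _ _).trans hfx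
    have hrA0 : 0 < rA := by linarith [abs_nonneg CA0]
    set σ : ℝ := E4.spatialNorm (Θ x) with hσ_def
    have hAσ := hCA0 (Θ x)
    rw [← hrA_def, ← hσ_def] at hAσ
    have hσ1 : 1 ≤ σ := by linarith [(abs_le.1 hAσ).2, le_abs_self CA0]
    have hσ0 : 0 < σ := one_pos.trans_le hσ1
    have hσup : σ ≤ (|C₄| + |CA0|) * r := by
      have e1 : σ ≤ rA + |CA0| := by linarith [(abs_le.1 hAσ).1, le_abs_self CA0]
      have e2 : rA ≤ |C₄| * r := h4b.trans (mul_le_mul_of_nonneg_right (le_abs_self _) hr.le)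
      have e3 : |CA0| ≤ |CA0| * r := le_mul_of_one_le_right (abs_nonneg _) hr1
      have e4 : (|C₄| + |CA0|) * r = |C₄| * r + |CA0| * r := by ring
      rw [e4]
      linarith
    -- (K1) the isometry at `(e₀, e₀)`
    have he₀ : fderiv ℝ Θ x (E4.basisVector 0) = (1 : ℝ) • E4.basisVector 0 :=
      fderiv_apply_basisVector_zero_of_contDiffOn hSo (by simp) hΘs hΘT hx
    rw [one_smul] at he₀
    have hiso := hΘiso x hx (E4.basisVector 0) (E4.basisVector 0)
    rw [he₀, kerr_bilin_basisVector_zero_zero] at hiso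
    -- (K2) closeness to Schwarzschild at order zero
    have h0 := hder ⟨Θ x, hΘmaps hx⟩ hRA 0 (by norm_num)
    rw [norm_iteratedFDeriv_zero] at h0
    simp only [zero_add] at h0
    have hcomp := (A.bilin (Θ x) - Kerr.bilin MA 0 (Θ x)).le_opNorm₂ (E4.basisVector 0) (E4.basisVector 0)
    rw [sub_apply, sub_apply, norm_basisVector_zero, mul_one, mul_one, Real.norm_eq_abs, hiso,
      kerr_bilin_basisVector_zero_zero, scalarH_zero_spin MA hσ0.ne'] at hcomp
    have hE : |2 * Kerr.scalarH M a x - 2 * (MA / σ)| ≤ |CA| * C₄ ^ 2 / r ^ 2 := by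
      have e : (-1 + 2 * Kerr.scalarH M a x) - (-1 + 2 * (MA / σ)) = 2 * Kerr.scalarH M a x - 2 * (MA / σ) := by
        ring
      rw [e] at hcomp
      refine hcomp.trans (h0.trans ?_)
      calc CA / rA ^ 2 ≤ |CA| / rA ^ 2 := by gcongr; exact le_abs_self _
        _ ≤ |CA| * C₄ ^ 2 / r ^ 2 := by
            rw [div_le_div_iff₀ (by positivity) (by positivity)]
            have : r ^ 2 ≤ (C₄ * rA) ^ 2 := pow_le_pow_left₀ hr.le h4a 2
            calc |CA| * r ^ 2 ≤ |CA| * (C₄ * rA) ^ 2 := mul_le_mul_of_nonneg_left this (abs_nonneg _)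
              _ = |CA| * C₄ ^ 2 * rA ^ 2 := by ring
    -- (K4) `H` against `M/r`
    have hHlo : M * r / (r ^ 2 + a ^ 2) ≤ Kerr.scalarH M a x := Kerr.div_le_scalarH hM.le hr
    have hHhi : Kerr.scalarH M a x ≤ M / r := Kerr.scalarH_le_div hM.le a hr
    have hH : |2 * Kerr.scalarH M a x - 2 * M / r| ≤ 2 * M * a ^ 2 / r ^ 2 := by
      rw [abs_sub_comm, abs_of_nonneg (by rw [mul_div_assoc]; linarith)]
      have e1 : M / r - M * r / (r ^ 2 + a ^ 2) = M * a ^ 2 / (r * (r ^ 2 + a ^ 2)) := by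
        field_simp
        ring
      have e2 : M * a ^ 2 / (r * (r ^ 2 + a ^ 2)) ≤ M * a ^ 2 / r ^ 2 :=
        div_le_div_of_nonneg_left (by positivity) (by positivity) (by nlinarith)
      have e3 : 2 * M / r - 2 * Kerr.scalarH M a x ≤ 2 * (M / r - M * r / (r ^ 2 + a ^ 2)) := by
        rw [mul_div_assoc]; linarith
      have e4 : 2 * M * a ^ 2 / r ^ 2 = 2 * (M * a ^ 2 / r ^ 2) := by ring
      rw [e4]
      linarith
    -- combine: `|2M_A/σ − 2M/r| ≤ C₉/r²`
    have hK : |2 * (MA / σ) - 2 * M / r| ≤ C₉ / r ^ 2 := by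
      have e : 2 * (MA / σ) - 2 * M / r =
          (2 * Kerr.scalarH M a x - 2 * M / r) - (2 * Kerr.scalarH M a x - 2 * (MA / σ)) := by ring
      rw [e]
      calc _ ≤ |2 * Kerr.scalarH M a x - 2 * M / r| + |2 * Kerr.scalarH M a x - 2 * (MA / σ)| := abs_sub _ _
        _ ≤ 2 * M * a ^ 2 / r ^ 2 + |CA| * C₄ ^ 2 / r ^ 2 := add_le_add hH hE
        _ = C₉ / r ^ 2 := by rw [hC₉]; ring
    have hmain : |MA * r - M * σ| ≤ C₁₀ := by
      have e : MA * r - M * σ = (σ * r / 2) * (2 * (MA / σ) - 2 * M / r) := by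
        field_simp
      rw [e, abs_mul, abs_of_pos (by positivity)]
      calc σ * r / 2 * |2 * (MA / σ) - 2 * M / r| ≤ σ * r / 2 * (C₉ / r ^ 2) := by gcongr
        _ = C₉ * σ / (2 * r) := by field_simp
        _ ≤ C₉ * ((|C₄| + |CA0|) * r) / (2 * r) := by gcongr
        _ = C₁₀ := by rw [hC₁₀]; field_simp
    -- (K6) `|σ − r| ≤ C₇ √r + |a|`
    have hσr : |σ - r| ≤ C₇ * Real.sqrt r + |a| := by
      have hd := hdrift x hx hR7
      have h1 : |E4.spatialNorm (Θ x) - E4.spatialNorm (Λ x)| ≤ ‖Θ x - Λ x‖ := by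
        have h := abs_norm_sub_norm_le (E4.spatial (Θ x)) (E4.spatial (Λ x))
        rw [← map_sub] at h
        exact h.trans (E4.spatialNorm_le_norm _)
      rw [spatialNorm_map_eq hΛ0 hΛη x] at h1
      have h3 : r ≤ E4.spatialNorm x := Kerr.radius_le_spatialNorm a x
      have h4' : E4.spatialNorm x ≤ r + |a| := spatialNorm_le_radius_add hr
      calc |σ - r| ≤ |σ - E4.spatialNorm x| + |E4.spatialNorm x - r| := abs_sub_le _ _ _
        _ ≤ C₇ * Real.sqrt r + |a| := add_le_add (h1.trans hd) (abs_sub_le_iff.2 ⟨by linarith, by linarith⟩)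
    exact ⟨hmain, hσr⟩
  /- Step A: the masses agree -/
  have hMA : MA = M := by
    by_contra hne
    have hd : 0 < |MA - M| := abs_pos.2 (sub_ne_zero.2 hne)
    set d : ℝ := |MA - M| with hd_def
    set K : ℝ := max Rbig (max (2 * (C₁₀ + M * |a|) / d + 1) ((2 * M * |C₇| / d) ^ 2 + 1)) with hK
    obtain ⟨x, hx, hxK⟩ := exists_mem_exterior_le_radius M a K
    obtain ⟨h1, h2⟩ := hpt x hx ((le_max_left _ _).trans hxK)
    set r : ℝ := Kerr.radius a x with hr_def
    have hr : 0 < r := Kerr.radius_pos_of_mem_region hx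
    have h3 : d * r ≤ C₁₀ + M * (C₇ * Real.sqrt r + |a|) := by
      have e : (MA - M) * r = (MA * r - M * E4.spatialNorm (Θ x)) + M * (E4.spatialNorm (Θ x) - r) := by ring
      calc d * r = |(MA - M) * r| := by rw [abs_mul, abs_of_pos hr]
        _ ≤ |MA * r - M * E4.spatialNorm (Θ x)| + |M * (E4.spatialNorm (Θ x) - r)| := by
            rw [e]; exact abs_add_le _ _
        _ ≤ C₁₀ + M * (C₇ * Real.sqrt r + |a|) := add_le_add h1 (by
            rw [abs_mul, abs_of_pos hM]; exact mul_le_mul_of_nonneg_left h2 hM.le)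
    have hK1 : 2 * (C₁₀ + M * |a|) / d + 1 ≤ r := ((le_max_left _ _).trans (le_max_right _ _)).trans hxK
    have hK2 : (2 * M * |C₇| / d) ^ 2 + 1 ≤ r := ((le_max_right _ _).trans (le_max_right _ _)).trans hxK
    have hnn : 0 ≤ 2 * M * |C₇| / d := by positivity
    have hsq : 2 * M * |C₇| / d < Real.sqrt r := by
      rw [show 2 * M * |C₇| / d = Real.sqrt ((2 * M * |C₇| / d) ^ 2) by rw [Real.sqrt_sq hnn]]
      exact Real.sqrt_lt_sqrt (sq_nonneg _) (by linarith)
    have hrr : Real.sqrt r * Real.sqrt r = r := Real.mul_self_sqrt hr.le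
    have hs0 : 0 < Real.sqrt r := Real.sqrt_pos.2 hr
    have e1 : 2 * (C₁₀ + M * |a|) + d ≤ d * r := by
      have := mul_le_mul_of_nonneg_left hK1 hd.le
      rw [mul_add, mul_div_cancel₀ _ hd.ne', mul_one] at this
      exact this
    have e2 : M * |C₇| * Real.sqrt r < d * r / 2 := by
      have t1 : 2 * M * |C₇| < Real.sqrt r * d := (div_lt_iff₀ hd).1 hsq
      have t2 : Real.sqrt r * (2 * M * |C₇|) < Real.sqrt r * (Real.sqrt r * d) := mul_lt_mul_of_pos_left t1 hs0
      have t3 : Real.sqrt r * (Real.sqrt r * d) = d * r := by rw [← mul_assoc, hrr, mul_comm]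
      have t4 : Real.sqrt r * (2 * M * |C₇|) = 2 * (M * |C₇| * Real.sqrt r) := by ring
      rw [t3, t4] at t2
      linarith
    have e3 : M * (C₇ * Real.sqrt r) ≤ M * |C₇| * Real.sqrt r := by
      rw [mul_assoc]
      exact mul_le_mul_of_nonneg_left (mul_le_mul_of_nonneg_right (le_abs_self _) hs0.le) hM.le
    rw [mul_add] at h3
    linarith
  /- Step B: assembly -/
  have hder' := hder
  rw [hMA] at hder'
  refine ⟨⟨CA, RA, hder'⟩, Rbig, |CA0| + C₁₀ / M, fun x hx hxR ↦ ?_⟩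
  obtain ⟨h1, -⟩ := hpt x hx hxR
  rw [hMA] at h1
  have h3 : |E4.spatialNorm (Θ x) - Kerr.radius a x| ≤ C₁₀ / M := by
    rw [le_div_iff₀ hM]
    calc |E4.spatialNorm (Θ x) - Kerr.radius a x| * M = |(E4.spatialNorm (Θ x) - Kerr.radius a x) * M| := by
          rw [abs_mul, abs_of_pos hM]
      _ = |M * Kerr.radius a x - M * E4.spatialNorm (Θ x)| := by
          rw [show (E4.spatialNorm (Θ x) - Kerr.radius a x) * M = M * E4.spatialNorm (Θ x) - M * Kerr.radius a x by
            ring, abs_sub_comm]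
      _ ≤ C₁₀ := h1
  calc |A.radius (Θ x) - Kerr.radius a x|
      ≤ |A.radius (Θ x) - E4.spatialNorm (Θ x)| + |E4.spatialNorm (Θ x) - Kerr.radius a x| := abs_sub_le _ _ _
    _ ≤ |CA0| + C₁₀ / M := add_le_add ((hCA0 _).trans (le_abs_self _)) h3

end Summit.FinalStateConjecture.FinalStateConjecture.Theorems.SymplecticDualOfTheBomb

end
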